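import Summits.BirchSwinnertonDyer.BirchSwinnertonDyer.Theorems.SylvesterTwoHeegnerIndexCMFlipLevelPair
import Summits.BirchSwinnertonDyer.BirchSwinnertonDyer.Theorems.SylvesterTwoHeegnerIndexCMFlipBlockOne
import Summits.BirchSwinnertonDyer.BirchSwinnertonDyer.Theorems.SylvesterTwoHeegnerIndexCMFlipPairLift
import Literature.NumberTheory.EllipticCurves.HuShuYin2019.SylvesterPairGoodPlaces
import HarnessLib

/-!
# (H-c2) of leaf (L1), crux `UpperOffV0HSYPlus` (stmt-BirchSwinnertonDyer-19804): BLOCK 2 OF (L1) AT ONE PAIR OF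
# KOLYVAGIN PRIMES from the coherent data — #F2's FLIP with `hES`, `hPmFrob`, `hsel₂` discharged, read with `c_A(ℓ')`

Skeleton of record VARIANT M; card v28; planner D472/D475.  ONE theorem `block2_of_level` (docstring below).
Theorems only; no `def`, no `sorry`, no new `Prop`; `set_option maxHeartbeats 1600000 in` scoped to the one theorem
(its statement carries #F2's binders).  Honest label: (F)+(G)+(H) close `stub_layerL1Four` only MODULO {`hD` #19,
`Dt`/`hdeg`, (ES2) = `Nekovar2007.cmPoint_frobeniusCongruence`}; BSD is not proved by any of this.
-/

set_option linter.dupNamespace false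
set_option autoImplicit false

noncomputable section

open scoped Classical Pointwise

namespace Summit.BirchSwinnertonDyer.BirchSwinnertonDyer.Theorems.SylvesterTwoCMFlip

open WeierstrassCurve Field NumberField IsDedekindDomain Finset
open Literature.NumberTheory.EllipticCurves Literature.NumberTheory.GaloisRepresentations
  Literature.NumberTheory.EllipticCurves.ModularForms
  Literature.NumberTheory.EllipticCurves.HuShuYin2019
  Literature.NumberTheory.EllipticCurves.KolyvaginCocycle
  Literature.NumberTheory.EllipticCurves.RingClassField
  Literature.NumberTheory.QuadraticFields Literature.NumberTheory.QuadraticFields.RingClass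
  Literature.NumberTheory.QuadraticFields.Quadratic
  Summit.BirchSwinnertonDyer.BirchSwinnertonDyer.Theorems.SylvesterTwoCMData
  Summit.BirchSwinnertonDyer.Rank1Residual.X11b Summit.BirchSwinnertonDyer.Rank1Residual.X11b.RingClassTower

variable {K : Type} [Field K] [NumberField K]

set_option maxHeartbeats 1600000 in
/-- **(H-c) BLOCK 2 OF (L1) AT ONE PAIR OF KOLYVAGIN PRIMES, from the coherent data.**  For the global data
(#H-a, #R-g) and TWO primes `ℓ ≠ ℓ'` satisfying `stub_layerL1Four`'s Kolyvagin clause: given the level-`9pℓ'`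
data of block 1 at `ℓ'` (`emb_{ℓ'}, ι_{ℓ'}, N_{ℓ'}, σ_{ℓ'}, y_{ℓ'}` and the well-formedness `hA₁', hQN', hP₁'` of
`c_A(ℓ') = c(ψ_A(P_{ℓ'}^{χ_A}))`, #H-b) and the level-`9pℓℓ'` data (`emb₂ ⊃ emb_{ℓ'} ⊃ emb₀` coherent, generators
`σ` of `Gal(K[9pℓℓ']/K[9pℓ'])` and `σ'` of `Gal(K[9pℓℓ']/K[9pℓ])` RESTRICTING TO `σ_{ℓ'}`, the CM points
`y_{ℓℓ'}`, `y_ℓ`): the class term `c_B(ℓℓ') = c(ψ_B(Σᵢ ρ_{tᵢ}(tᵢ • κ⁻¹ι₂(D_ℓ D_{ℓ'} y_{ℓℓ'}))))` is well-formed and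
**`c_B(ℓℓ')` Selmer at `λ ∋ ℓ` ↔ `c_A(ℓ') ∈ T_A(λ)`** — #F2 `flip_levelPair` with `hES` DISCHARGED (#20 on HSY's
tower, `Nekovar2007.cmPoint_frobeniusCongruence`), `hPmFrob` (Gross §3: `Frob_λ` fixes `K[9pℓ']`,
`IsKolyvaginPrime.smul_algHom_ringClassField_eq_self`), `hsel₂` (k-ty1 #11 at the level `9pℓ'` + #R-h
`kolyvaginClass_mono`), and the pair-level reading `κ⁻¹ι₂(D_{σ'} y_{ℓ'}↑) = P_{ℓ'}` (`derivOp_map_inclusion`).  The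
level is a FREE variable `m = 9p(ℓℓ')` (read at `9pn`, `n = ℓℓ'` or `ℓ'ℓ`, by the assembly).
[cite: GrossLMS1991, §3 Prop. 3.6–3.7, §4 (4.1)–(4.6), Prop. 6.2] [cite: McCallumLMS1991, §4–§5]
[cite: HuShuYin2019, §4.1, Prop. 4.6] [cite: Nekovar2007, Prop. 4.9] -/
theorem block2_of_level {ω : K} (hω : ω ^ 2 + ω + 1 = 0) (h2 : Module.finrank ℚ K = 2)
    (ι : K →+* ℂ) (hES2 : Nekovar2007.cmPoint_frobeniusCongruence)
    (Dt : ModularParametrizationData (⟨0, 0, 1, 0, -1⟩ : WeierstrassCurve ℚ) 243)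
    {p ℓ ℓ' : ℕ} (hp : p.Prime) (hp3 : p % 3 = 1)
    (hKol : ℓ.Prime ∧ ¬ ℓ ∣ (cubeSumCurve (3 * (p : ℚ) ^ 2)).conductorNorm ℤ ∧
      ¬ ℓ ∣ (cubeSumCurve (p : ℚ)).conductorNorm ℤ ∧ ¬ ((ℓ : ℤ) ∣ NumberField.discr K) ∧ ℓ ≠ 2 ∧
      (Ideal.span {(ℓ : 𝓞 K)}).IsPrime ∧
      FrobEqFrobInfty (cubeSumCurve (3 * (p : ℚ) ^ 2)) K 2 ℓ ∧ FrobEqFrobInfty (cubeSumCurve (p : ℚ)) K 2 ℓ)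
    (hKol' : ℓ'.Prime ∧ ¬ ℓ' ∣ (cubeSumCurve (3 * (p : ℚ) ^ 2)).conductorNorm ℤ ∧
      ¬ ℓ' ∣ (cubeSumCurve (p : ℚ)).conductorNorm ℤ ∧ ¬ ((ℓ' : ℤ) ∣ NumberField.discr K) ∧ ℓ' ≠ 2 ∧
      (Ideal.span {(ℓ' : 𝓞 K)}).IsPrime ∧
      FrobEqFrobInfty (cubeSumCurve (3 * (p : ℚ) ^ 2)) K 2 ℓ' ∧ FrobEqFrobInfty (cubeSumCurve (p : ℚ)) K 2 ℓ')
    (hne : ℓ ≠ ℓ') {m : ℕ} (hm : 9 * p * (ℓ * ℓ') = m)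
    (κ : geomPoints ((cubeSumCurve 9).baseChange K) ≃+ geomPoints ((⟨0, 0, 1, 0, -1⟩ : WeierstrassCurve ℚ).baseChange K))
    (hκG : ∀ (g : absoluteGaloisGroup K) (P : geomPoints ((cubeSumCurve 9).baseChange K)), κ (g • P) = g • κ P)
    (hκ : ∀ {x y : AlgebraicClosure K}
      (h : (((cubeSumCurve 9).baseChange K).baseChange (AlgebraicClosure K)).toAffine.Nonsingular x y),
      ∃ h', κ (.some x y h) = .some (x / 36) ((y - 108) / 216) h')
    {vB vA : AlgebraicClosure K} (hvBc : vB ^ 3 = algebraMap ℚ (AlgebraicClosure K) ((p : ℚ) / 9))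
    (hvB : vB ≠ 0) (hvAc : vA ^ 3 = algebraMap ℚ (AlgebraicClosure K) ((p : ℚ) ^ 2 / 3)) (hvA0 : vA ≠ 0)
    (hvB3 : ∀ g : absoluteGaloisGroup K, ((show AlgebraicClosure K ≃ₐ[K] AlgebraicClosure K from g) vB) ^ 3 = vB ^ 3)
    (hvA3 : ∀ g : absoluteGaloisGroup K, ((show AlgebraicClosure K ≃ₐ[K] AlgebraicClosure K from g) vA) ^ 3 = vA ^ 3)
    {ψB : geomPoints ((cubeSumCurve 9).baseChange K) ≃+ geomPoints ((cubeSumCurve (p : ℚ)).baseChange K)}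
    {ψA : geomPoints ((cubeSumCurve 9).baseChange K) ≃+ geomPoints ((cubeSumCurve (3 * (p : ℚ) ^ 2)).baseChange K)}
    (hψB : ∀ {x y : AlgebraicClosure K}
      (h : (((cubeSumCurve 9).baseChange K).baseChange (AlgebraicClosure K)).toAffine.Nonsingular x y),
      ∃ h', ψB (Affine.Point.some x y h) = Affine.Point.some (vB ^ 2 * x) (vB ^ 3 * y) h')
    (hψA : ∀ {x y : AlgebraicClosure K}
      (h : (((cubeSumCurve 9).baseChange K).baseChange (AlgebraicClosure K)).toAffine.Nonsingular x y),
      ∃ h', ψA (Affine.Point.some x y h) = Affine.Point.some (vA ^ 2 * x) (vA ^ 3 * y) h')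
    {ρ : absoluteGaloisGroup K → geomPoints ((cubeSumCurve 9).baseChange K) ≃+ geomPoints ((cubeSumCurve 9).baseChange K)}
    (hρ : ∀ (g : absoluteGaloisGroup K) {x y : AlgebraicClosure K}
        (h : (((cubeSumCurve 9).baseChange K).baseChange (AlgebraicClosure K)).toAffine.Nonsingular x y),
        ∃ h', ρ g (Affine.Point.some x y h) =
          Affine.Point.some (((show AlgebraicClosure K ≃ₐ[K] AlgebraicClosure K from g) vB / vB) ^ 2 * x) y h')
    (hρρ : ∀ (g : absoluteGaloisGroup K) {x y : AlgebraicClosure K}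
        (h : (((cubeSumCurve 9).baseChange K).baseChange (AlgebraicClosure K)).toAffine.Nonsingular x y),
        ∃ h', ρ g (ρ g (Affine.Point.some x y h)) =
          Affine.Point.some (((show AlgebraicClosure K ≃ₐ[K] AlgebraicClosure K from g) vA / vA) ^ 2 * x) y h')
    (hlawB : ∀ (g : absoluteGaloisGroup K) (P : geomPoints ((cubeSumCurve 9).baseChange K)),
        g • ψB P = ψB (ρ g (g • P)))
    (hlawA : ∀ (g : absoluteGaloisGroup K) (P : geomPoints ((cubeSumCurve 9).baseChange K)),
        g • ψA P = ψA (ρ g (ρ g (g • P))))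
    (hρcomm : ∀ (g h : absoluteGaloisGroup K) (P : geomPoints ((cubeSumCurve 9).baseChange K)),
        h • ρ g P = ρ g (h • P))
    (emb₀ : ringClassField K ι (9 * p) →+* AlgebraicClosure K)
    (hemb₀ : ∀ k : K, emb₀ (algebraMap K (ringClassField K ι (9 * p)) k) = algebraMap K (AlgebraicClosure K) k)
    (N₀ : Subgroup (absoluteGaloisGroup K))
    (hN₀ : ∀ g : absoluteGaloisGroup K, g ∈ N₀ ↔
      ∀ x : ringClassField K ι (9 * p), (show AlgebraicClosure K ≃ₐ[K] AlgebraicClosure K from g) (emb₀ x) = emb₀ x)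
    {ιt : Type} [Fintype ιt] (t : ιt → absoluteGaloisGroup K)
    (ht : Function.Bijective fun i ↦ (t i : absoluteGaloisGroup K ⧸ N₀))
    {y₁ : ((⟨0, 0, 1, 0, -1⟩ : WeierstrassCurve ℚ).baseChange (ringClassField K ι (9 * p))).toAffine.Point}
    (hy₁ : Affine.Point.map (W' := (⟨0, 0, 1, 0, -1⟩ : WeierstrassCurve ℚ)) (ringClassField K ι (9 * p)).subtype.toRatAlgHom y₁ =
      Dt.φ (heegnerTau (81 * ((p : ℤ) ^ 2 + 4 * p + 16), -(9 * (4 * (p : ℤ) ^ 2 + 17 * p + 72)),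
        4 * (p : ℤ) ^ 2 + 18 * p + 81)))
    (hle₀' : ringClassField K ι (9 * p) ≤ ringClassField K ι (9 * p * ℓ'))
    (emb' : ringClassField K ι (9 * p * ℓ') →+* AlgebraicClosure K)
    (hemb' : ∀ k : K, emb' (algebraMap K (ringClassField K ι (9 * p * ℓ')) k) = algebraMap K (AlgebraicClosure K) k)
    (hcoh₀' : ∀ x : ringClassField K ι (9 * p), emb' (RingClassField.inclusion ι hle₀' x) = emb₀ x)
    (ιe' : letI : DecidableEq (ringClassField K ι (9 * p * ℓ')) := fun a b ↦ Classical.propDecidable (a = b)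
      ((⟨0, 0, 1, 0, -1⟩ : WeierstrassCurve ℚ).baseChange (ringClassField K ι (9 * p * ℓ'))).toAffine.Point →+ geomPoints ((⟨0, 0, 1, 0, -1⟩ : WeierstrassCurve ℚ).baseChange K))
    (hιe' : ∀ P, ιe' P = Affine.Point.map (W' := (⟨0, 0, 1, 0, -1⟩ : WeierstrassCurve ℚ)) emb'.toRatAlgHom P)
    (N' : Subgroup (absoluteGaloisGroup K))
    (hN'' : ∀ g : absoluteGaloisGroup K, g ∈ N' ↔
      ∀ x : ringClassField K ι (9 * p * ℓ'), (show AlgebraicClosure K ≃ₐ[K] AlgebraicClosure K from g) (emb' x) = emb' x)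
    {σℓ' : ringClassField K ι (9 * p * ℓ') ≃ₐ[ℚ] ringClassField K ι (9 * p * ℓ')}
    (hσℓ' : Subgroup.zpowers σℓ' = ringClassGalOver ι (9 * p * ℓ') (9 * p))
    {yℓ'₀ : ((⟨0, 0, 1, 0, -1⟩ : WeierstrassCurve ℚ).baseChange (ringClassField K ι (9 * p * ℓ'))).toAffine.Point}
    (hyℓ'₀ : Affine.Point.map (W' := (⟨0, 0, 1, 0, -1⟩ : WeierstrassCurve ℚ)) (ringClassField K ι (9 * p * ℓ')).subtype.toRatAlgHom yℓ'₀ =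
      Dt.φ (heegnerTau ((ℓ' : ℤ) ^ 2 * (81 * ((p : ℤ) ^ 2 + 4 * p + 16)),
        (ℓ' : ℤ) * (-(9 * (4 * (p : ℤ) ^ 2 + 17 * p + 72))), 4 * (p : ℤ) ^ 2 + 18 * p + 81)))
    {hdivA : ∀ P : geomPoints ((cubeSumCurve (3 * (p : ℚ) ^ 2)).baseChange K),
      ∃ R : geomPoints ((cubeSumCurve (3 * (p : ℚ) ^ 2)).baseChange K), ((2 : ℕ) : ℤ) • R = P}
    {hdivB : ∀ P : geomPoints ((cubeSumCurve (p : ℚ)).baseChange K),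
      ∃ R : geomPoints ((cubeSumCurve (p : ℚ)).baseChange K), ((2 : ℕ) : ℤ) • R = P}
    (hA₁' : IsAdmissible (absoluteGaloisGroup K)
      ((FixedPoints.addSubgroup N' (geomPoints ((cubeSumCurve 9).baseChange K))).map ψA.toAddMonoidHom) ((2 : ℕ) : ℤ))
    (hQN' : (∑ i, ρ (t i) (ρ (t i) (t i •
        κ.symm (ιe' (KolyvaginOperator.derivOp (pointGalHom (⟨0, 0, 1, 0, -1⟩ : WeierstrassCurve ℚ) (ringClassField K ι (9 * p * ℓ'))) σℓ' ℓ' yℓ'₀))))) ∈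
      FixedPoints.addSubgroup N' (geomPoints ((cubeSumCurve 9).baseChange K)))
    (hP₁' : ψA (∑ i, ρ (t i) (ρ (t i) (t i •
        κ.symm (ιe' (KolyvaginOperator.derivOp (pointGalHom (⟨0, 0, 1, 0, -1⟩ : WeierstrassCurve ℚ) (ringClassField K ι (9 * p * ℓ'))) σℓ' ℓ' yℓ'₀))))) ∈
      invPoints (absoluteGaloisGroup K)
        ((FixedPoints.addSubgroup N' (geomPoints ((cubeSumCurve 9).baseChange K))).map ψA.toAddMonoidHom) ((2 : ℕ) : ℤ))
    (hN'vA : ∀ h ∈ N', (show AlgebraicClosure K ≃ₐ[K] AlgebraicClosure K from h) vA = vA)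
    (hle'2 : ringClassField K ι (9 * p * ℓ') ≤ ringClassField K ι m)
    (hle₀2 : ringClassField K ι (9 * p) ≤ ringClassField K ι m)
    (emb : ringClassField K ι m →+* AlgebraicClosure K)
    (hemb : ∀ k : K, emb (algebraMap K (ringClassField K ι m) k) = algebraMap K (AlgebraicClosure K) k)
    (hcoh'2 : ∀ x : ringClassField K ι (9 * p * ℓ'), emb (RingClassField.inclusion ι hle'2 x) = emb' x)
    (hcoh₀2 : ∀ x : ringClassField K ι (9 * p), emb (RingClassField.inclusion ι hle₀2 x) = emb₀ x)
    (ιe : letI : DecidableEq (ringClassField K ι m) := fun a b ↦ Classical.propDecidable (a = b)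
      ((⟨0, 0, 1, 0, -1⟩ : WeierstrassCurve ℚ).baseChange (ringClassField K ι m)).toAffine.Point →+ geomPoints ((⟨0, 0, 1, 0, -1⟩ : WeierstrassCurve ℚ).baseChange K))
    (hιe : ∀ P, ιe P = Affine.Point.map (W' := (⟨0, 0, 1, 0, -1⟩ : WeierstrassCurve ℚ)) emb.toRatAlgHom P)
    (N : Subgroup (absoluteGaloisGroup K))
    (hN : ∀ g : absoluteGaloisGroup K, g ∈ N ↔
      ∀ x : ringClassField K ι m, (show AlgebraicClosure K ≃ₐ[K] AlgebraicClosure K from g) (emb x) = emb x)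
    {σ σ' : ringClassField K ι m ≃ₐ[ℚ] ringClassField K ι m}
    (hσ : Subgroup.zpowers σ = ringClassGalOver ι m (9 * p * ℓ'))
    (hσ' : Subgroup.zpowers σ' = ringClassGalOver ι m (9 * p * ℓ))
    (hσ'res : ∀ x : ringClassField K ι (9 * p * ℓ'),
      σ' (RingClassField.inclusion ι hle'2 x) = RingClassField.inclusion ι hle'2 (σℓ' x))
    {y yℓ : ((⟨0, 0, 1, 0, -1⟩ : WeierstrassCurve ℚ).baseChange (ringClassField K ι m)).toAffine.Point}
    (hy : Affine.Point.map (W' := (⟨0, 0, 1, 0, -1⟩ : WeierstrassCurve ℚ)) (ringClassField K ι m).subtype.toRatAlgHom y =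
      Dt.φ (heegnerTau (((ℓ * ℓ' : ℕ) : ℤ) ^ 2 * (81 * ((p : ℤ) ^ 2 + 4 * p + 16)),
        ((ℓ * ℓ' : ℕ) : ℤ) * (-(9 * (4 * (p : ℤ) ^ 2 + 17 * p + 72))), 4 * (p : ℤ) ^ 2 + 18 * p + 81)))
    (hyℓ : Affine.Point.map (W' := (⟨0, 0, 1, 0, -1⟩ : WeierstrassCurve ℚ)) (ringClassField K ι m).subtype.toRatAlgHom yℓ =
      Dt.φ (heegnerTau ((ℓ : ℤ) ^ 2 * (81 * ((p : ℤ) ^ 2 + 4 * p + 16)),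
        (ℓ : ℤ) * (-(9 * (4 * (p : ℤ) ^ 2 + 17 * p + 72))), 4 * (p : ℤ) ^ 2 + 18 * p + 81))) :
    ∃ (hA₁ : IsAdmissible (absoluteGaloisGroup K)
        ((FixedPoints.addSubgroup N (geomPoints ((cubeSumCurve 9).baseChange K))).map ψB.toAddMonoidHom) ((2 : ℕ) : ℤ))
      (_ : (∑ i, ρ (t i) (t i • κ.symm (ιe (KolyvaginOperator.derivOp (pointGalHom (⟨0, 0, 1, 0, -1⟩ : WeierstrassCurve ℚ) (ringClassField K ι m)) σ ℓ
          (KolyvaginOperator.derivOp (pointGalHom (⟨0, 0, 1, 0, -1⟩ : WeierstrassCurve ℚ) (ringClassField K ι m)) σ' ℓ' y))))) ∈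
        FixedPoints.addSubgroup N (geomPoints ((cubeSumCurve 9).baseChange K)))
      (hP₁ : ψB (∑ i, ρ (t i) (t i • κ.symm (ιe (KolyvaginOperator.derivOp (pointGalHom (⟨0, 0, 1, 0, -1⟩ : WeierstrassCurve ℚ) (ringClassField K ι m)) σ ℓ
          (KolyvaginOperator.derivOp (pointGalHom (⟨0, 0, 1, 0, -1⟩ : WeierstrassCurve ℚ) (ringClassField K ι m)) σ' ℓ' y))))) ∈
        invPoints (absoluteGaloisGroup K)
          ((FixedPoints.addSubgroup N (geomPoints ((cubeSumCurve 9).baseChange K))).map ψB.toAddMonoidHom) ((2 : ℕ) : ℤ)),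
      (∀ h ∈ N, (show AlgebraicClosure K ≃ₐ[K] AlgebraicClosure K from h) vB = vB) ∧
      ∀ (v : HeightOneSpectrum (𝓞 K)), (ℓ : 𝓞 K) ∈ v.asIdeal →
        (kolyvaginClass ((cubeSumCurve (p : ℚ)).baseChange K) ((2 : ℕ) : ℤ) hdivB hA₁
            (ψB (∑ i, ρ (t i) (t i • κ.symm (ιe (KolyvaginOperator.derivOp (pointGalHom (⟨0, 0, 1, 0, -1⟩ : WeierstrassCurve ℚ) (ringClassField K ι m)) σ ℓ
              (KolyvaginOperator.derivOp (pointGalHom (⟨0, 0, 1, 0, -1⟩ : WeierstrassCurve ℚ) (ringClassField K ι m)) σ' ℓ' y)))))) hP₁ ∈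
            selmerLocalKer ((cubeSumCurve (p : ℚ)).baseChange K) (v.adicCompletion K) ((2 : ℕ) : ℤ) ↔
          kolyvaginClass ((cubeSumCurve (3 * (p : ℚ) ^ 2)).baseChange K) ((2 : ℕ) : ℤ) hdivA hA₁'
              (ψA (∑ i, ρ (t i) (ρ (t i) (t i •
                κ.symm (ιe' (KolyvaginOperator.derivOp (pointGalHom (⟨0, 0, 1, 0, -1⟩ : WeierstrassCurve ℚ) (ringClassField K ι (9 * p * ℓ'))) σℓ' ℓ' yℓ'₀)))))) hP₁' ∈
            ((cubeSumCurve (3 * (p : ℚ) ^ 2)).baseChange K).torsionLocalKer (v.adicCompletion K) ((2 : ℕ) : ℤ)) := by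
  subst hm
  obtain ⟨hℓ, hℓA, -, hℓdK, hℓ2, hinert, hFrobA, hFrobB⟩ := hKol
  obtain ⟨hℓ', -, -, hℓ'dK, hℓ'2, hinert', -, hFrobB'⟩ := hKol'
  haveI : Fact ℓ.Prime := ⟨hℓ⟩
  obtain ⟨hℓ3, hℓp⟩ := mod_three_eq_two_of_clause hω h2 hp hp3 hℓ hℓdK hFrobB
  obtain ⟨hℓ'3, hℓ'p⟩ := mod_three_eq_two_of_clause hω h2 hp hp3 hℓ' hℓ'dK hFrobB'
  have hK := JZero.isImaginaryQuadratic_of_sq_add_self_add_one hω h2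
  have hdK := JZero.discr_eq_neg_three_of_sq_add_self_add_one hω h2
  have hp0 : p ≠ 0 := hp.ne_zero
  have hp2 : p ≠ 2 := by rintro rfl; norm_num at hp3
  have hℓ3ne : ℓ ≠ 3 := by rintro rfl; norm_num at hℓ3
  have hℓ'3ne : ℓ' ≠ 3 := by rintro rfl; norm_num at hℓ'3
  have hp_odd : Odd p := hp.eq_two_or_odd'.resolve_left hp2
  have hℓ_odd : Odd ℓ := hℓ.eq_two_or_odd'.resolve_left hℓ2
  have hℓ'_odd : Odd ℓ' := hℓ'.eq_two_or_odd'.resolve_left hℓ'2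
  haveI := isElliptic_sylvesterNineMinimal
  haveI := isGloballyMinimal_sylvesterNineMinimal
  have hΔ := not_dvd_minimalDiscriminantInt_sylvesterNineMinimal hℓ hℓ3ne
  have hΔ' := not_dvd_minimalDiscriminantInt_sylvesterNineMinimal hℓ' hℓ'3ne
  have hMa : ((2 ^ 1 : ℕ) : ℤ) ∣ (⟨0, 0, 1, 0, -1⟩ : WeierstrassCurve ℚ).LFunction ℓ := by
    rw [JZero.lFunction_eq_zero_of_j_eq_zero_of_mod_three_eq_two _ j_sylvesterNineMinimal hℓ hℓ3 hℓ2 hΔ]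
    exact dvd_zero _
  have hMa' : ((2 ^ 1 : ℕ) : ℤ) ∣ (⟨0, 0, 1, 0, -1⟩ : WeierstrassCurve ℚ).LFunction ℓ' := by
    rw [JZero.lFunction_eq_zero_of_j_eq_zero_of_mod_three_eq_two _ j_sylvesterNineMinimal hℓ' hℓ'3 hℓ'2 hΔ']
    exact dvd_zero _
  have hMℓ : 2 ^ 1 ∣ ℓ + 1 := by rw [pow_one]; exact hℓ_odd.add_one.two_dvd
  have hMℓ' : 2 ^ 1 ∣ ℓ' + 1 := by rw [pow_one]; exact hℓ'_odd.add_one.two_dvd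
  have hf : 9 * p ≠ 0 := mul_ne_zero (by norm_num) hp0
  have hm0' : 9 * p * ℓ' ≠ 0 := mul_ne_zero hf hℓ'.ne_zero
  have hn0 : 9 * p * (ℓ * ℓ') ≠ 0 := mul_ne_zero hf (mul_ne_zero hℓ.ne_zero hℓ'.ne_zero)
  have hℓ9p' : ¬ ℓ ∣ 9 * p * ℓ' := fun h ↦ by
    rcases (Nat.Prime.dvd_mul hℓ).mp h with h1 | h2'
    · rcases (Nat.Prime.dvd_mul hℓ).mp h1 with h9 | hp'
      · exact hℓ3ne ((Nat.prime_dvd_prime_iff_eq hℓ Nat.prime_three).mp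
          (hℓ.dvd_of_dvd_pow (by norm_num at h9 ⊢; exact h9 : ℓ ∣ 3 ^ 2)))
      · exact hℓp hp'
    · exact hne ((Nat.prime_dvd_prime_iff_eq hℓ hℓ').mp h2')
  haveI := (finiteDimensional_and_isGalois_ringClassField hK ι hn0).2
  haveI := (finiteDimensional_and_isGalois_ringClassField hK ι hm0').2
  have hN₀2 := mem_iff_forall_mem_nine_mul ι hle₀2 emb₀ emb hcoh₀2 hN₀
  have hN₀' := mem_iff_forall_mem_nine_mul ι hle₀' emb₀ emb' hcoh₀' hN₀
  set yℓ' : ((⟨0, 0, 1, 0, -1⟩ : WeierstrassCurve ℚ).baseChange (ringClassField K ι (9 * p * (ℓ * ℓ')))).toAffine.Point :=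
    Affine.Point.map (W' := (⟨0, 0, 1, 0, -1⟩ : WeierstrassCurve ℚ)) ((RingClassField.inclusion ι hle'2).restrictScalars ℚ) yℓ'₀ with hyℓ'def
  have hyℓ' : Affine.Point.map (W' := (⟨0, 0, 1, 0, -1⟩ : WeierstrassCurve ℚ)) (ringClassField K ι (9 * p * (ℓ * ℓ'))).subtype.toRatAlgHom yℓ' =
      Dt.φ (heegnerTau ((ℓ' : ℤ) ^ 2 * (81 * ((p : ℤ) ^ 2 + 4 * p + 16)),
        (ℓ' : ℤ) * (-(9 * (4 * (p : ℤ) ^ 2 + 17 * p + 72))), 4 * (p : ℤ) ^ 2 + 18 * p + 81)) := by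
    rw [← hyℓ'₀, hyℓ'def]
    exact map_toRatAlgHom_map_inclusion (W := (⟨0, 0, 1, 0, -1⟩ : WeierstrassCurve ℚ)) ι hle'2 (ringClassField K ι (9 * p * (ℓ * ℓ'))).subtype
      (ringClassField K ι (9 * p * ℓ')).subtype (fun x' ↦ RingClassField.coe_inclusion ι hle'2 x') yℓ'₀
  set y₀' : ((⟨0, 0, 1, 0, -1⟩ : WeierstrassCurve ℚ).baseChange (ringClassField K ι (9 * p * ℓ'))).toAffine.Point :=
    Affine.Point.map (W' := (⟨0, 0, 1, 0, -1⟩ : WeierstrassCurve ℚ)) ((RingClassField.inclusion ι hle₀').restrictScalars ℚ) y₁ with hy₀'def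
  have hy₀' : Affine.Point.map (W' := (⟨0, 0, 1, 0, -1⟩ : WeierstrassCurve ℚ)) (ringClassField K ι (9 * p * ℓ')).subtype.toRatAlgHom y₀' =
      Dt.φ (heegnerTau (81 * ((p : ℤ) ^ 2 + 4 * p + 16), -(9 * (4 * (p : ℤ) ^ 2 + 17 * p + 72)),
        4 * (p : ℤ) ^ 2 + 18 * p + 81)) := by
    rw [← hy₁, hy₀'def]
    exact map_toRatAlgHom_map_inclusion (W := (⟨0, 0, 1, 0, -1⟩ : WeierstrassCurve ℚ)) ι hle₀' (ringClassField K ι (9 * p * ℓ')).subtype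
      (ringClassField K ι (9 * p)).subtype (fun x' ↦ RingClassField.coe_inclusion ι hle₀' x') y₁
  have hPm : ιe (KolyvaginOperator.derivOp (pointGalHom (⟨0, 0, 1, 0, -1⟩ : WeierstrassCurve ℚ) (ringClassField K ι (9 * p * (ℓ * ℓ')))) σ' ℓ' yℓ') =
      ιe' (KolyvaginOperator.derivOp (pointGalHom (⟨0, 0, 1, 0, -1⟩ : WeierstrassCurve ℚ) (ringClassField K ι (9 * p * ℓ'))) σℓ' ℓ' yℓ'₀) := by
    rw [hyℓ'def, derivOp_map_inclusion ι hle'2 hσ'res ℓ' yℓ'₀, hιe, hιe']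
    exact map_toRatAlgHom_map_inclusion (W := (⟨0, 0, 1, 0, -1⟩ : WeierstrassCurve ℚ)) ι hle'2 emb emb' hcoh'2 _
  have hPnN := mem_fixedPoints_symm_of_equivariant κ hκG N
    (map_emb_mem_fixedPoints (⟨0, 0, 1, 0, -1⟩ : WeierstrassCurve ℚ) ι emb ιe hιe N hN
      (KolyvaginOperator.derivOp (pointGalHom (⟨0, 0, 1, 0, -1⟩ : WeierstrassCurve ℚ) (ringClassField K ι (9 * p * (ℓ * ℓ')))) σ ℓ
        (KolyvaginOperator.derivOp (pointGalHom (⟨0, 0, 1, 0, -1⟩ : WeierstrassCurve ℚ) (ringClassField K ι (9 * p * (ℓ * ℓ')))) σ' ℓ' y)))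
  have hPraw := exists_fixedPoints_zsmul_eq_smul_map_derivOp_derivOp_sub hK hdK ι Dt hp3 hℓ hℓ3 hℓ' hℓ'3 hne
    hℓp hℓ'p hinert hinert' hMℓ hMℓ' hMa hMa' hσ hσ' hy hyℓ hyℓ' emb hemb ιe hιe N hN N₀ hN₀2
  obtain ⟨hNn, -, -, -, hNvB, hA₁B, hA₂A, hP₁B, -⟩ := coupledFrame_levelPackage hω h2 ι hp0
    (mul_ne_zero hℓ.ne_zero hℓ'.ne_zero) hp_odd (hℓ_odd.mul hℓ'_odd) hvBc hvB hvAc hvA0 hvB3 hvA3 hρ hρρ hlawB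
    hlawA emb hemb N hN N₀ hN₀2 t ht 1 _ hPnN
    (fun h hh ↦ exists_fixedPoints_zsmul_eq_symm_of_equivariant κ hκG N (hPraw h hh))
  have hPmN := mem_fixedPoints_symm_of_equivariant κ hκG N
    (map_emb_mem_fixedPoints (⟨0, 0, 1, 0, -1⟩ : WeierstrassCurve ℚ) ι emb ιe hιe N hN
      (KolyvaginOperator.derivOp (pointGalHom (⟨0, 0, 1, 0, -1⟩ : WeierstrassCurve ℚ) (ringClassField K ι (9 * p * (ℓ * ℓ')))) σ' ℓ' yℓ'))
  have hN2le : N ≤ N' := fun g hg ↦ (hN'' g).mpr fun x ↦ by rw [← hcoh'2]; exact (hN g).mp hg _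
  have hPraw' := exists_fixedPoints_zsmul_eq_smul_map_derivOp_sub hK hdK ι Dt hp3 hℓ' hℓ'3 hℓ'p hinert' hMℓ'
    hMa' hσℓ' hyℓ'₀ hy₀' emb' hemb' ιe' hιe' N' hN'' N₀ hN₀'
  have hPm' : ∀ h ∈ N₀, ∃ a ∈ FixedPoints.addSubgroup N (geomPoints ((cubeSumCurve 9).baseChange K)),
      ((2 ^ 1 : ℕ) : ℤ) • a =
        h • κ.symm (ιe (KolyvaginOperator.derivOp
            (pointGalHom (⟨0, 0, 1, 0, -1⟩ : WeierstrassCurve ℚ) (ringClassField K ι (9 * p * (ℓ * ℓ')))) σ' ℓ' yℓ')) -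
          κ.symm (ιe (KolyvaginOperator.derivOp
            (pointGalHom (⟨0, 0, 1, 0, -1⟩ : WeierstrassCurve ℚ) (ringClassField K ι (9 * p * (ℓ * ℓ')))) σ' ℓ' yℓ')) := by
    intro h hh
    obtain ⟨a, ha, e⟩ := exists_fixedPoints_zsmul_eq_symm_of_equivariant κ hκG N' (hPraw' h hh)
    refine ⟨a, ?_, ?_⟩
    · rw [JZero.mem_fixedPoints_iff] at ha ⊢
      exact fun g hg ↦ ha g (hN2le hg)
    · rw [hPm]; exact e
  obtain ⟨-, -, -, -, -, -, -, -, hP₂A⟩ := coupledFrame_levelPackage hω h2 ι hp0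
    (mul_ne_zero hℓ.ne_zero hℓ'.ne_zero) hp_odd (hℓ_odd.mul hℓ'_odd) hvBc hvB hvAc hvA0 hvB3 hvA3 hρ hρρ hlawB
    hlawA emb hemb N hN N₀ hN₀2 t ht 1 _ hPmN hPm'
  have hA₁ : IsAdmissible (absoluteGaloisGroup K)
      ((FixedPoints.addSubgroup N (geomPoints ((cubeSumCurve 9).baseChange K))).map ψB.toAddMonoidHom)
      ((2 : ℕ) : ℤ) := hA₁B
  have hA₂ : IsAdmissible (absoluteGaloisGroup K)
      ((FixedPoints.addSubgroup N (geomPoints ((cubeSumCurve 9).baseChange K))).map ψA.toAddMonoidHom)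
      ((2 : ℕ) : ℤ) := hA₂A
  have hP₁ : ψB (∑ i, ρ (t i) (t i • κ.symm (ιe (KolyvaginOperator.derivOp
        (pointGalHom (⟨0, 0, 1, 0, -1⟩ : WeierstrassCurve ℚ) (ringClassField K ι (9 * p * (ℓ * ℓ')))) σ ℓ
        (KolyvaginOperator.derivOp (pointGalHom (⟨0, 0, 1, 0, -1⟩ : WeierstrassCurve ℚ) (ringClassField K ι (9 * p * (ℓ * ℓ')))) σ' ℓ' y))))) ∈
      invPoints (absoluteGaloisGroup K)
        ((FixedPoints.addSubgroup N (geomPoints ((cubeSumCurve 9).baseChange K))).map ψB.toAddMonoidHom)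
        ((2 : ℕ) : ℤ) := hP₁B
  have hP₂ : ψA (∑ i, ρ (t i) (ρ (t i) (t i • κ.symm (ιe (KolyvaginOperator.derivOp
        (pointGalHom (⟨0, 0, 1, 0, -1⟩ : WeierstrassCurve ℚ) (ringClassField K ι (9 * p * (ℓ * ℓ')))) σ' ℓ' yℓ'))))) ∈
      invPoints (absoluteGaloisGroup K)
        ((FixedPoints.addSubgroup N (geomPoints ((cubeSumCurve 9).baseChange K))).map ψA.toAddMonoidHom)
        ((2 : ℕ) : ℤ) := hP₂A
  haveI : N.Normal := hNn
  have hQN : (∑ i, ρ (t i) (t i • κ.symm (ιe (KolyvaginOperator.derivOp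
        (pointGalHom (⟨0, 0, 1, 0, -1⟩ : WeierstrassCurve ℚ) (ringClassField K ι (9 * p * (ℓ * ℓ')))) σ ℓ
        (KolyvaginOperator.derivOp (pointGalHom (⟨0, 0, 1, 0, -1⟩ : WeierstrassCurve ℚ) (ringClassField K ι (9 * p * (ℓ * ℓ')))) σ' ℓ' y))))) ∈
      FixedPoints.addSubgroup N (geomPoints ((cubeSumCurve 9).baseChange K)) :=
    chiComponent_mem (fun g ↦ (ρ g).toAddMonoidHom) (fun g _ ha ↦ JZero.smul_mem_fixedPoints _ N g ha)
      (fun g _ ha ↦ JZero.rho_mem_fixedPoints _ hω hvB hvB3 hρ N g ha) t hPnN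
  have hκ' : ∀ {x y : AlgebraicClosure K}
      (h : (((cubeSumCurve 9).baseChange K).baseChange (AlgebraicClosure K)).toAffine.Nonsingular x y),
      ∃ h', κ (.some x y h) = .some ((36 : AlgebraicClosure K)⁻¹ * x)
        ((216 : AlgebraicClosure K)⁻¹ * y + -(1 / 2)) h' := by
    intro x y h
    obtain ⟨h', e⟩ := hκ h
    have ex : x / 36 = (36 : AlgebraicClosure K)⁻¹ * x := by ring
    have ey : (y - 108) / 216 = (216 : AlgebraicClosure K)⁻¹ * y + -(1 / 2) := by ring
    exact ⟨ex ▸ ey ▸ h', e.trans (Affine.Point.some_eq_some_of_eq ex ey)⟩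
  have hKolA : IsKolyvaginPrime ((cubeSumCurve (3 * (p : ℚ) ^ 2)).conductorNorm ℤ)
      (cubeSumCurve (3 * (p : ℚ) ^ 2)) K 2 ℓ := ⟨hℓ, hℓA, hℓdK, hℓ2, hinert, hFrobA⟩
  have hPmFrob : ∀ (v : HeightOneSpectrum (𝓞 K)), (ℓ : 𝓞 K) ∈ v.asIdeal →
      ∀ 𝔓 ∈ v.primesAbove, ∀ F : absoluteGaloisGroup K, IsArithFrobAt (𝓞 K) F 𝔓 →
        F • κ.symm (ιe (KolyvaginOperator.derivOp
            (pointGalHom (⟨0, 0, 1, 0, -1⟩ : WeierstrassCurve ℚ) (ringClassField K ι (9 * p * (ℓ * ℓ')))) σ' ℓ' yℓ')) =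
          κ.symm (ιe (KolyvaginOperator.derivOp
            (pointGalHom (⟨0, 0, 1, 0, -1⟩ : WeierstrassCurve ℚ) (ringClassField K ι (9 * p * (ℓ * ℓ')))) σ' ℓ' yℓ')) := by
    intro v hv 𝔓 h𝔓 F hF
    have hvpl : v = hKolA.place := hKolA.mem_iff.mp hv
    have hfixF : ∀ x : ringClassField K ι (9 * p * ℓ'),
        (show AlgebraicClosure K ≃ₐ[K] AlgebraicClosure K from F) (emb' x) = emb' x := fun x ↦
      IsKolyvaginPrime.smul_algHom_ringClassField_eq_self hKolA hK ι hm0' hℓ9p'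
        ({ emb' with commutes' := hemb' } : ringClassField K ι (9 * p * ℓ') →ₐ[K] AlgebraicClosure K)
        (by rw [← hvpl]; exact h𝔓) hF x
    apply κ.injective
    rw [hκG, κ.apply_symm_apply, hPm]
    exact smul_embPoints_eq_self (⟨0, 0, 1, 0, -1⟩ : WeierstrassCurve ℚ) emb' ιe' hιe' F hfixF _
  have hmapmono : (FixedPoints.addSubgroup N' (geomPoints ((cubeSumCurve 9).baseChange K))).map ψA.toAddMonoidHom ≤
      (FixedPoints.addSubgroup N (geomPoints ((cubeSumCurve 9).baseChange K))).map ψA.toAddMonoidHom := by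
    refine AddSubgroup.map_mono fun a ha ↦ ?_
    rw [JZero.mem_fixedPoints_iff] at ha ⊢
    exact fun g hg ↦ ha g (hN2le hg)
  have hcls : kolyvaginClass ((cubeSumCurve (3 * (p : ℚ) ^ 2)).baseChange K) ((2 : ℕ) : ℤ) hdivA hA₂
      (ψA (∑ i, ρ (t i) (ρ (t i) (t i • κ.symm (ιe (KolyvaginOperator.derivOp
        (pointGalHom (⟨0, 0, 1, 0, -1⟩ : WeierstrassCurve ℚ) (ringClassField K ι (9 * p * (ℓ * ℓ')))) σ' ℓ' yℓ')))))) hP₂ =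
      kolyvaginClass ((cubeSumCurve (3 * (p : ℚ) ^ 2)).baseChange K) ((2 : ℕ) : ℤ) hdivA hA₁'
        (ψA (∑ i, ρ (t i) (ρ (t i) (t i •
          κ.symm (ιe' (KolyvaginOperator.derivOp (pointGalHom (⟨0, 0, 1, 0, -1⟩ : WeierstrassCurve ℚ) (ringClassField K ι (9 * p * ℓ'))) σℓ' ℓ' yℓ'₀))))))
        hP₁' := by
    have key : ∀ {P : geomPoints ((cubeSumCurve (3 * (p : ℚ) ^ 2)).baseChange K)}
        (hP : P ∈ invPoints (absoluteGaloisGroup K)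
          ((FixedPoints.addSubgroup N (geomPoints ((cubeSumCurve 9).baseChange K))).map ψA.toAddMonoidHom)
          ((2 : ℕ) : ℤ))
        (e : P = ψA (∑ i, ρ (t i) (ρ (t i) (t i •
          κ.symm (ιe' (KolyvaginOperator.derivOp (pointGalHom (⟨0, 0, 1, 0, -1⟩ : WeierstrassCurve ℚ) (ringClassField K ι (9 * p * ℓ'))) σℓ' ℓ' yℓ'₀)))))),
        kolyvaginClass ((cubeSumCurve (3 * (p : ℚ) ^ 2)).baseChange K) ((2 : ℕ) : ℤ) hdivA hA₂ P hP =
          kolyvaginClass ((cubeSumCurve (3 * (p : ℚ) ^ 2)).baseChange K) ((2 : ℕ) : ℤ) hdivA hA₁' _ hP₁' := by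
      intro P hP e
      subst e
      exact (kolyvaginClass_mono hA₁' hA₂ hmapmono hP₁' hP).symm
    exact key hP₂ (by rw [hPm])
  have hsel₂ : ∀ (v : HeightOneSpectrum (𝓞 K)), (ℓ : 𝓞 K) ∈ v.asIdeal →
      kolyvaginClass ((cubeSumCurve (3 * (p : ℚ) ^ 2)).baseChange K) ((2 : ℕ) : ℤ) hdivA hA₂
        (ψA (∑ i, ρ (t i) (ρ (t i) (t i • κ.symm (ιe (KolyvaginOperator.derivOp
          (pointGalHom (⟨0, 0, 1, 0, -1⟩ : WeierstrassCurve ℚ) (ringClassField K ι (9 * p * (ℓ * ℓ')))) σ' ℓ' yℓ')))))) hP₂ ∈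
        selmerLocalKer ((cubeSumCurve (3 * (p : ℚ) ^ 2)).baseChange K) (v.adicCompletion K) ((2 : ℕ) : ℤ) := by
    intro v hv
    rw [hcls]
    have h3v : ((3 : ℕ) : 𝓞 K) ∉ v.asIdeal := not_natCast_mem_of_prime_ne hℓ Nat.prime_three hℓ3ne v hv
    have hpv : ((p : ℕ) : 𝓞 K) ∉ v.asIdeal :=
      not_natCast_mem_of_prime_ne hℓ hp (fun h ↦ hℓp (h ▸ dvd_rfl)) v hv
    have hℓ'v : ((ℓ' : ℕ) : 𝓞 K) ∉ v.asIdeal := not_natCast_mem_of_prime_ne hℓ hℓ' hne v hv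
    have hmv : ((9 * p * ℓ' : ℕ) : 𝓞 K) ∉ v.asIdeal := by
      intro h
      push_cast at h
      rcases v.isPrime.mem_or_mem h with h1 | h2'
      · rcases v.isPrime.mem_or_mem h1 with h9 | hp'
        · have h9' : ((3 : ℕ) : 𝓞 K) * ((3 : ℕ) : 𝓞 K) ∈ v.asIdeal := by push_cast; norm_num; exact h9
          rcases v.isPrime.mem_or_mem h9' with h3 | h3 <;> exact h3v h3
        · exact hpv (by exact_mod_cast hp')
      · exact hℓ'v (by exact_mod_cast h2')
    exact kolyvaginClass_cmFrame_cubeSumCurve_three_mul_sq_mem_selmerLocalKer hK ι hm0' emb' hemb' N' hN'' hp hp2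
      hψA hN'vA hA₁' hQN' hP₁' v h3v hpv hmv
  have hES : ∀ (φ₀ : absoluteGaloisGroup (ZMod ℓ)), (∀ x : AlgebraicClosure (ZMod ℓ), φ₀ • x = x ^ ℓ) →
      ∀ (g : absoluteGaloisGroup K)
        (γ : ringClassField K ι (9 * p * (ℓ * ℓ')) ≃ₐ[ℚ] ringClassField K ι (9 * p * (ℓ * ℓ'))),
        geomReduction hΔ ((RatClosure.pointsEquiv (K := K) (⟨0, 0, 1, 0, -1⟩ : WeierstrassCurve ℚ)).symm
            (g • ιe (pointGalHom (⟨0, 0, 1, 0, -1⟩ : WeierstrassCurve ℚ) (ringClassField K ι (9 * p * (ℓ * ℓ'))) γ y))) =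
          φ₀ • geomReduction hΔ ((RatClosure.pointsEquiv (K := K) (⟨0, 0, 1, 0, -1⟩ : WeierstrassCurve ℚ)).symm
            (g • ιe (pointGalHom (⟨0, 0, 1, 0, -1⟩ : WeierstrassCurve ℚ) (ringClassField K ι (9 * p * (ℓ * ℓ'))) γ yℓ'))) := by
    intro φ₀ hφ₀ g γ
    rw [hιe, hιe]
    exact geomReduction_pair_eq_frob_smul hES2 hK hdK ι Dt hp3 hℓ2 hℓ3 hℓ' hℓ'3 hne hℓp hinert
      (m := 9 * p * (ℓ * ℓ')) (by ring) hy hyℓ' (Affine.Point.map (W' := (⟨0, 0, 1, 0, -1⟩ : WeierstrassCurve ℚ)) emb.toRatAlgHom) emb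
      (fun hab ↦ ⟨_, rfl⟩) hΔ hφ₀ g γ
  refine ⟨hA₁, hQN, hP₁, hNvB, fun v hv ↦ ?_⟩
  have hflip := flip_levelPair hω h2 ι Dt hp hp3 hℓ3 hℓ2 hℓp hℓ' hℓ'3 hne hℓ'p hℓA hℓdK hFrobA hΔ κ hκG hκ' hvBc
    hvB hvAc hvA0 hvB3 hvA3 hψB hψA hρ hρρ hlawB hlawA hρcomm emb hemb ιe hιe N hN N₀ hN₀2 t hσ hσ' hy hyℓ'
    (hdivA := hdivA) (hdivB := hdivB) hA₁ hA₂ hP₁ hP₂ v hv (hPmFrob v hv) (hsel₂ v hv) hES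
  rwa [hcls] at hflip

end Summit.BirchSwinnertonDyer.BirchSwinnertonDyer.Theorems.SylvesterTwoCMFlip

end
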